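import Literature.NumberTheory.IwasawaTheory.ClassGroupPRankLeOfNotElementaryLayer
import Literature.NumberTheory.IwasawaTheory.ClassGroupCoinvariantGenusCriterionRank
import Literature.NumberTheory.IwasawaTheory.ClassGroupPRankLeOneOfNonNormUnitLayerTwo
import HarnessLib

/-!
# THE QUADRATIC-STEP UNIT DOOR at `p = 2`: `2 ∤ h_K`, Fukuda index `0`, `ord₂ h(K_1) ≤ 1`, at most two primes of `K_k` ramified in `K_{k+1}`,
# and ONE unit of the LAYER `K_k` outside `N_{K_{k+1}/K_k} K_{k+1}ˣ` (any `k ≥ 0`) ⟹ `rank₂ Cl(K_m) ≤ 2^{k+1} − 2 ∀ m`, `μ₂ = 0`, `λ₂ ≤ 2^{k+1} − 2`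

Topic `NumberTheory/IwasawaTheory` (namespace = path).  THEOREMS ONLY (no definition, no named fact, no instance, no `sorry`); unconditional.
Written by the prover seat `bsd-line-att-p4` g42 (cell `bsd-f1-sign2`, WIDTH-5 attach on route `AlignedTransportAtTwo`, crux C2 stmt-BirchSwinnertonDyer-22298;
`--supports`, closes nothing; no class group is computed here; BSD is not advanced by this file).

WHY.  Over a base with `e_0 = 0`, `e_1 ≤ 1` and Fukuda index `0`, `μ > 0` pins EVERY layer: `Cl(K_j)[2^∞] ≅ (ℤ/2)^{2^j − 1}` (tree: the elementary-layer
door `classicalMuVanishes_and_classicalLambda_le_of_classNumberPExp_ne` and `classGroupPRank_le_pow_sub_one`).  Apply CHEVALLEY's ambiguous class number formula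
(tree `ambiguousClassNumberFormula`) to the QUADRATIC step `K_{k+1}/K_k` (not to `K_{k+1}/K`): `#Cl(K_{k+1})^σ · 2 · [E_{K_k} : E_{K_k} ∩ N K_{k+1}ˣ] = h(K_k) · 2^t`
(`t ≤ 2` ramified primes, unramified at infinity).  The involution `σ` acts on the `𝔽₂`-space `Cl(K_{k+1})[2]` of dimension `2^{k+1} − 1`, and
**an involution of `𝔽₂^{2^{k+1}−1}` fixes at least `2^{2^k}` points** (`(σ − 1)² = 0`: image ⊆ kernel; `card_le_sq_card_fixed_of_involution`), so
`2^{2^k} ∣ #Cl(K_{k+1})^σ`; with `ord₂ h(K_k) = 2^k − 1` the formula forces the unit index to be ODD — i.e. EVERY unit of `K_k` is a norm from `K_{k+1}`.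
Contrapositive: a non-norm unit at the step `k → k+1` kills `μ > 0`; quantitatively (door L10 / the class-number test) `rank₂ Cl(K_m) ≤ 2^{k+1} − 2 ∀ m`, `μ₂ = 0`,
`λ₂ ≤ 2^{k+1} − 2`.

READING (Washington §13.3 with `X = Λ/J` cyclic, two ramified primes): the index `[E_{K_k} : E_{K_k} ∩ N K_{k+1}ˣ]` is `2` iff `ν_k X = 0` (the tower has STABILISED:
`X = A_k` finite, `λ = μ = 0`) and `1` otherwise — so this door is the lower-bound certificate of the FINITE-`X` regime, complementary to the order-four door
(att-p4 g41, `…ClassGroupLayerThreeOrderFourOfTowerCertificate`), which fires iff `1 ≤ λ ≤ 2^k − 2` is visible at layer `k`.  The cell's customers (census, att-p4 g42):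
the hard-core seeds `1259`, `14891` of the u7 sub-cell (`Cl(K_3)[2^∞] ≅ (ℤ/2)⁵`, a unit `η ∈ E_{K_3}` with `N_{K_3/K}(η) = −ε⁴`, `ε⁴ ≢ ±1 (mod 𝔭₁⁶)`).

* `card_le_sq_card_fixed_of_involution` — `A` a finite commutative group of exponent `2`, `f` an involutive endomorphism ⟹ `#A ≤ #{a | f a = a}²`.
* ★★★ `classicalMuVanishes_two_of_two_dvd_unitsNormIndex_layer_succ` — THE DOOR with the non-norm datum as `2 ∣ [E_{K_k} : E_{K_k} ∩ N K_{k+1}ˣ]`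
  (Chevalley's index inside `K_{k+1}ˣ`, as in `AmbiguousClassNumberFormula.lean`).
* ★★★ `classicalMuVanishes_two_of_unit_not_mem_norm_layer_succ` — the same with ONE unit `u` of `K_k` outside `N_{K_{k+1}/K_k} K_{k+1}ˣ` displayed
  (tree `dvd_relIndex_unitsNorm_of_not_mem`).

HONEST SCOPE: classical (Chevalley–Lang genus theory at one quadratic step + Washington §13.3 at finite level via the tree's elementary-layer door); nothing specific
to any summit; no certificate for any field is asserted; BSD is not advanced by this file.  Not found in print in this form (presearch: corpus hybrid
«unit norm index layer Iwasawa mu invariant stabilization» / «ambiguous class involution elementary abelian» — Fukuda 1994 Thm 1 (stabilisation by class NUMBERS),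
Washington §13.3, Lang Ch. 13 §4, Gras IV.4 are the ingredients; galaxy — none).

References: [Lang1990] S. Lang, *Cyclotomic Fields I and II*, GTM 121, Ch. 13 §4 Lemma 4.1 (PDF p. 203); [Washington1997] §13.3 Prop. 13.22–13.23, Lemma 13.18;
[Fukuda1994] T. Fukuda, Proc. Japan Acad. 70 A (1994), Thm. 1, p. 264; [Gras2003] G. Gras, *Class Field Theory*, II.6.2.3, IV.4.
-/

set_option autoImplicit false

noncomputable section

open scoped NumberField
open NumberField IsDedekindDomain Field

namespace Literature.NumberTheory.IwasawaTheory

open Literature.NumberTheory.EllipticCurves Literature.NumberTheory.NumberFields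
  Literature.NumberTheory.NumberFields.AmbiguousClass
  Literature.NumberTheory.GaloisRepresentations Literature.NumberTheory.GaloisRepresentations.Herbrand
  Literature.NumberTheory.GaloisRepresentations.MinkowskiUnit
  Literature.NumberTheory.GaloisRepresentations.CyclicNormIndex

/-! ## §1 An involution of an elementary abelian `2`-group fixes at least the square root of its order -/

/-- **An involution of a finite group of exponent `2` fixes at least `√#A` points**: for `f ∘ f = id` on a commutative group `A` with `a² = 1` for all `a`, the
endomorphism `a ↦ f(a)·a⁻¹` has kernel the fixed points and image inside the fixed points (`f(f(a)a⁻¹) = a·f(a)⁻¹ = (f(a)a⁻¹)⁻¹ = f(a)a⁻¹`), so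
`#A = #ker · #im ≤ #Fix²`. [cite: Lang1990, Ch. 13 §4 (ambiguous classes; the operator `σ − 1`)] -/
theorem card_le_sq_card_fixed_of_involution {A : Type*} [CommGroup A] [Finite A] (hA : ∀ a : A, a ^ 2 = 1)
    (f : A →* A) (hf : ∀ a, f (f a) = a) :
    Nat.card A ≤ Nat.card {a : A // f a = a} ^ 2 := by
  classical
  have hinv : ∀ a : A, a⁻¹ = a := fun a => by
    rw [inv_eq_iff_mul_eq_one, ← sq]; exact hA a
  -- the endomorphism `φ a = f a * a⁻¹`
  let φ : A →* A :=
    { toFun := fun a => f a * a⁻¹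
      map_one' := by rw [map_one, inv_one, mul_one]
      map_mul' := fun a b => by rw [map_mul, mul_inv, mul_mul_mul_comm] }
  have hφ : ∀ a, φ a = f a * a⁻¹ := fun _ => rfl
  have hker : ∀ a, a ∈ φ.ker ↔ f a = a := fun a => by
    rw [MonoidHom.mem_ker, hφ, mul_inv_eq_one]
  -- the image lies in the kernel
  have hrange : φ.range ≤ φ.ker := by
    rintro _ ⟨a, rfl⟩
    rw [hker, hφ, map_mul, hf, map_inv, hinv, hinv, mul_comm]
  have hcardker : Nat.card φ.ker = Nat.card {a : A // f a = a} :=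
    Nat.card_congr (Equiv.subtypeEquivRight fun a => hker a)
  have h1 : Nat.card A = Nat.card (A ⧸ φ.ker) * Nat.card φ.ker := Subgroup.card_eq_card_quotient_mul_card_subgroup φ.ker
  have h2 : Nat.card (A ⧸ φ.ker) = Nat.card φ.range := Nat.card_congr (QuotientGroup.quotientKerEquivRange φ).toEquiv
  have h3 : Nat.card φ.range ≤ Nat.card φ.ker := Subgroup.card_le_of_le hrange
  rw [h1, h2, sq, ← hcardker]
  exact Nat.mul_le_mul_right _ h3

/-- Corollary in `2`-adic form: if moreover `#A = 2^r`, then `2^s ∣ #{fixed}` for every `s` with `2s ≤ r + 1`... stated as: `#{a | f a = a}` is a power of two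
`2^a` with `r ≤ 2a`. [cite: Lang1990, Ch. 13 §4] -/
theorem exists_card_fixed_eq_two_pow_of_involution {A : Type*} [CommGroup A] [Finite A] (hA : ∀ a : A, a ^ 2 = 1)
    (f : A →* A) (hf : ∀ a, f (f a) = a) {r : ℕ} (hr : Nat.card A = 2 ^ r) :
    ∃ a : ℕ, Nat.card {x : A // f x = x} = 2 ^ a ∧ r ≤ 2 * a := by
  classical
  -- the fixed points form a subgroup of the `2`-group `A`
  let Fx : Subgroup A :=
    { carrier := {x | f x = x}
      mul_mem' := fun {a b} ha hb => by simp only [Set.mem_setOf_eq] at ha hb ⊢; rw [map_mul, ha, hb]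
      one_mem' := by simp only [Set.mem_setOf_eq, map_one]
      inv_mem' := fun {a} ha => by simp only [Set.mem_setOf_eq] at ha ⊢; rw [map_inv, ha] }
  have hFx : Nat.card {x : A // f x = x} = Nat.card Fx := rfl
  have hA2 : IsPGroup 2 A := IsPGroup.of_card hr
  obtain ⟨a, ha⟩ := (hA2.to_subgroup Fx).exists_card_eq
  refine ⟨a, by rw [hFx, ha], ?_⟩
  have hle := card_le_sq_card_fixed_of_involution hA f hf
  rw [hr, hFx, ha, ← pow_mul] at hle
  by_contra hlt
  push Not at hlt
  have : 2 ^ (a * 2) < 2 ^ r := Nat.pow_lt_pow_right (by norm_num) (by omega)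
  omega

/-! ## §2 The door -/

variable {K : Type} [Field K] [NumberField K]

/-- ★★★ **THE QUADRATIC-STEP UNIT DOOR (index form).**  `κ` a `ℤ₂`-extension of `K` with Fukuda index `0`, `2 ∤ h_K` (`e_0 = 0`), `ord₂ h(K_1) ≤ 1`, any `k`;
at the quadratic step `M = K_k ⊆ L = K_{k+1}` (inclusion algebra structure) at most two primes of `M` ramify in `L` and the unit norm index
`[E_M : E_M ∩ N_{L/M} Lˣ]` is EVEN.  THEN `rank₂ Cl(K_m) ≤ 2^{k+1} − 2` for every `m`, `μ₂(κ) = 0` and `λ₂(κ) ≤ 2^{k+1} − 2`.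
Proof: if `rank₂ Cl(K_{k+1}) < 2^{k+1} − 1` the small-rank door; if `ord₂ h(K_k) ≠ 2^k − 1` the class-number test; otherwise `Cl(K_{k+1})[2]` is an `𝔽₂`-space of
dimension `2^{k+1} − 1` on which the generator `σ` of `Gal(L/M)` is an involution with `≥ 2^{2^k}` fixed points, all ambiguous, and Chevalley's formula
`#Cl(L)^σ · 2 · idx = h(M) · 2^t` (`t ≤ 2`, unramified at infinity) gives `2^k + 1 + 1 ≤ (2^k − 1) + 2` — absurd.
[cite: Lang1990, Ch. 13 §4, Lemma 4.1 (PDF p. 203)] [cite: Washington1997, §13.3 Prop. 13.22–13.23] [cite: Fukuda1994, Thm. 1, p. 264] -/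
theorem classicalMuVanishes_two_of_two_dvd_unitsNormIndex_layer_succ (κ : ZpExtension K 2) (hκ : TotallyRamifiedFrom κ 0)
    (h0 : classNumberPExp κ 0 = 0) (h1 : classNumberPExp κ 1 ≤ 1) {k : ℕ}
    [NumberField (κ.layer k)] [NumberField (κ.layer (k + 1))]
    (ht : letI : Algebra (κ.layer k) (κ.layer (k + 1)) := (IntermediateField.inclusion (κ.layer_mono (Nat.le_succ k))).toRingHom.toAlgebra
      {v : HeightOneSpectrum (𝓞 (κ.layer k)) | v.asIdeal.ramificationIdxIn (𝓞 (κ.layer (k + 1))) ≠ 1}.ncard ≤ 2)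
    (hidx : letI : Algebra (κ.layer k) (κ.layer (k + 1)) := (IntermediateField.inclusion (κ.layer_mono (Nat.le_succ k))).toRingHom.toAlgebra
      2 ∣ (unitsE (κ.layer (k + 1)) ⊓ (⊤ : Subgroup (κ.layer (k + 1))ˣ).map
            (Herbrand.norm ((κ.layer (k + 1)) ≃ₐ[κ.layer k] (κ.layer (k + 1))))).relIndex
          (unitsE (κ.layer (k + 1)) ⊓ (unitsIncl (κ.layer k) (κ.layer (k + 1))).range)) :
    (∀ m, classGroupPRank κ m ≤ 2 ^ (k + 1) - 2) ∧ ClassicalMuVanishes κ ∧ classicalLambda κ ≤ 2 ^ (k + 1) - 2 := by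
  classical
  haveI : Fact (Nat.Prime 2) := ⟨Nat.prime_two⟩
  set M := κ.layer k with hMdef
  set L := κ.layer (k + 1) with hLdef
  have hML : κ.layer k ≤ κ.layer (k + 1) := κ.layer_mono (Nat.le_succ k)
  letI : Algebra M L := (IntermediateField.inclusion hML).toRingHom.toAlgebra
  haveI : IsScalarTower K M L := IsScalarTower.of_algebraMap_eq fun x => ((IntermediateField.inclusion hML).commutes x).symm
  haveI : FiniteDimensional K M := κ.finiteDimensional_layer_holds _
  haveI : FiniteDimensional K L := κ.finiteDimensional_layer_holds _
  haveI : IsGalois K L := κ.isGalois_layer_holds _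
  haveI : FiniteDimensional M L := Module.Finite.of_restrictScalars_finite K M L
  haveI : IsGalois M L := isGalois_layer_layer κ
  haveI : IsUnramifiedAtInfinitePlaces K L := κ.isUnramifiedAtInfinitePlaces_layer _
  haveI : IsUnramifiedAtInfinitePlaces M L := IsUnramifiedAtInfinitePlaces.top K M L
  haveI : IsCyclic (L ≃ₐ[M] L) := isCyclic_aut_layer_layer' κ
  obtain ⟨σ, hσ⟩ := IsCyclic.exists_generator (α := L ≃ₐ[M] L)
  have hdeg : Module.finrank M L = 2 := by
    rw [finrank_layer_layer κ (show k ≤ k + 1 by omega), Nat.add_sub_cancel_left, pow_one]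
  have h2k : 2 ^ k - 2 ≤ 2 ^ (k + 1) - 2 := by
    have := Nat.pow_le_pow_right (show 0 < 2 by norm_num) (Nat.le_succ k); omega
  -- (a) small rank at layer k+1
  rcases Nat.lt_or_ge (classGroupPRank κ (k + 1)) (2 ^ (k + 1) - 1) with hlt | hge
  · have hsmall : classGroupPRank κ (0 + (k + 1)) < 2 ^ (k + 1) - 1 := by rwa [Nat.zero_add]
    have hbound : ∀ m, classGroupPRank κ m ≤ 2 ^ (k + 1) - 2 := fun m => by
      have h := classGroupPRank_le_of_lt_pow_sub_one κ hκ (le_refl 0) hsmall m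
      rw [Nat.zero_add, Nat.zero_add] at h
      omega
    obtain ⟨hmu, hlam⟩ := classicalLambda_le_of_lt_pow_sub_one κ hκ (le_refl 0) hsmall
    rw [Nat.zero_add] at hlam
    exact ⟨hbound, hmu, by omega⟩
  -- (b) class-number test at layer k
  by_cases he : classNumberPExp κ k = 2 ^ k - 1
  swap
  · have h := classicalMuVanishes_and_classicalLambda_le_of_classNumberPExp_ne κ hκ h0 h1 he
    exact ⟨fun m => (h.1 m).trans h2k, h.2.1, h.2.2.trans h2k⟩
  -- (c) the contradiction
  exfalso
  have hr : classGroupPRank κ (k + 1) = 2 ^ (k + 1) - 1 := le_antisymm (classGroupPRank_le_pow_sub_one κ hκ h0 h1 (k + 1)) hge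
  -- the `2`-torsion of `Cl(L)` and the involution induced by `σ`
  set T : Subgroup (ClassGroup (𝓞 L)) := (powMonoidHom 2 : ClassGroup (𝓞 L) →* ClassGroup (𝓞 L)).ker with hT
  have hmemT : ∀ x : ClassGroup (𝓞 L), x ∈ T ↔ x ^ 2 = 1 := fun x => by rw [hT, MonoidHom.mem_ker, powMonoidHom_apply]
  have hcardT : Nat.card T = 2 ^ (2 ^ (k + 1) - 1) := by
    rw [← hr, ← natCard_torsion_classGroup_layer_eq κ (k + 1)]
    exact Nat.card_congr (Equiv.subtypeEquivRight fun x => hmemT x)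
  set g : ClassGroup (𝓞 L) ≃* ClassGroup (𝓞 L) := ClassGroup.mulEquiv (intAut σ) with hg
  have hgT : ∀ x : ClassGroup (𝓞 L), x ∈ T → g x ∈ T := fun x hx => by
    rw [hmemT] at hx ⊢; rw [← map_pow, hx, map_one]
  let f : T →* T :=
    { toFun := fun x => ⟨g x, hgT x x.2⟩
      map_one' := Subtype.ext (by simp only [OneMemClass.coe_one, map_one])
      map_mul' := fun a b => Subtype.ext (by simp only [Subgroup.coe_mul, map_mul]) }
  have hf : ∀ x : T, ((f x : T) : ClassGroup (𝓞 L)) = g x := fun _ => rfl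
  -- `σ² = 1`
  have hcardG : Nat.card (L ≃ₐ[M] L) = 2 := by
    rw [card_aut_layer_layer κ (show k ≤ k + 1 by omega), Nat.add_sub_cancel_left, pow_one]
  have hσ2 : σ * σ = 1 := by
    rw [← sq, ← hcardG]; exact pow_card_eq_one'
  have hgg : ∀ x : ClassGroup (𝓞 L), g (g x) = x := fun x => by
    rw [hg, ← MulEquiv.trans_apply, ← mulEquiv_intAut_mul, hσ2, mulEquiv_intAut_one, MulEquiv.refl_apply]
  have hff : ∀ x : T, f (f x) = x := fun x => Subtype.ext (by rw [hf, hf, hgg])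
  have hT2 : ∀ x : T, x ^ 2 = 1 := fun x => Subtype.ext (by rw [Subgroup.coe_pow, (hmemT x).mp x.2, Subgroup.coe_one])
  haveI : Finite T := inferInstance
  obtain ⟨a, ha, hra⟩ := exists_card_fixed_eq_two_pow_of_involution hT2 f hff hcardT
  -- fixed points of `f` on `T` ↪ the ambiguous classes of `L/M`
  obtain ⟨H, hH⟩ := isSubgroup_fixed (K := M) (L := L)
  have hfix_iff : ∀ c : ClassGroup (𝓞 L), (∀ τ : L ≃ₐ[M] L, ClassGroup.mulEquiv (intAut τ) c = c) ↔ g c = c := by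
    intro c
    refine ⟨fun h => h σ, fun h τ => ?_⟩
    obtain ⟨n, rfl⟩ := Herbrand.exists_pow_eq_of_forall_mem_zpowers hσ τ
    induction n with
    | zero => rw [pow_zero, mulEquiv_intAut_one, MulEquiv.refl_apply]
    | succ n ih => rw [pow_succ, mulEquiv_intAut_mul, MulEquiv.trans_apply, ← hg, h, ih]
  -- the subgroup of `Cl(L)` of `f`-fixed elements of `T`
  let TF : Subgroup (ClassGroup (𝓞 L)) :=
    { carrier := {c | c ∈ T ∧ g c = c}
      mul_mem' := fun {x y} hx hy => ⟨T.mul_mem hx.1 hy.1, by rw [map_mul, hx.2, hy.2]⟩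
      one_mem' := ⟨T.one_mem, map_one g⟩
      inv_mem' := fun {x} hx => ⟨T.inv_mem hx.1, by rw [map_inv, hx.2]⟩ }
  have hTF_card : Nat.card TF = 2 ^ a := by
    rw [← ha]
    refine Nat.card_congr ⟨fun c => ⟨⟨c.1, c.2.1⟩, Subtype.ext (by rw [hf]; exact c.2.2)⟩,
      fun x => ⟨(x.1 : ClassGroup (𝓞 L)), ⟨x.1.2, by have := congrArg Subtype.val x.2; rwa [hf] at this⟩⟩,
      fun c => rfl, fun x => rfl⟩
  have hTF_le : TF ≤ H := by
    intro c hc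
    have : c ∈ (H : Set (ClassGroup (𝓞 L))) := by rw [hH]; exact (hfix_iff c).mpr hc.2
    exact this
  have hdvd : 2 ^ a ∣ Nat.card {c : ClassGroup (𝓞 L) // ∀ τ : L ≃ₐ[M] L, ClassGroup.mulEquiv (intAut τ) c = c} := by
    have hcH : Nat.card {c : ClassGroup (𝓞 L) // ∀ τ : L ≃ₐ[M] L, ClassGroup.mulEquiv (intAut τ) c = c} = Nat.card H :=
      Nat.card_congr (Equiv.setCongr hH.symm)
    rw [hcH, ← hTF_card]
    exact Subgroup.card_dvd_of_le hTF_le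
  -- Chevalley at the quadratic step
  have hchev := ambiguousClassNumberFormula hσ
  rw [hdeg, archFactor_eq_one, mul_one, finprod_ramificationIdxIn_eq_pow_of_prime Nat.prime_two hdeg] at hchev
  -- 2-adic valuations: `a + 1 + v(idx) = e_k + t`
  set Fx := Nat.card {c : ClassGroup (𝓞 L) // ∀ τ : L ≃ₐ[M] L, ClassGroup.mulEquiv (intAut τ) c = c} with hFx
  set idx := (unitsE L ⊓ (⊤ : Subgroup Lˣ).map (Herbrand.norm (L ≃ₐ[M] L))).relIndex (unitsE L ⊓ (unitsIncl M L).range) with hidxdef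
  set t := {v : HeightOneSpectrum (𝓞 M) | v.asIdeal.ramificationIdxIn (𝓞 L) ≠ 1}.ncard with htdef
  have hidx0 : idx ≠ 0 := (relIndex_unitsNorm_ne_zero hσ).1
  haveI : Nonempty {c : ClassGroup (𝓞 L) // ∀ τ : L ≃ₐ[M] L, ClassGroup.mulEquiv (intAut τ) c = c} := ⟨⟨1, fun τ => map_one _⟩⟩
  have hFx0 : Fx ≠ 0 := by
    rw [hFx]; exact Nat.card_pos.ne'
  have hhM : classNumber M ≠ 0 := (classNumber_pos (K := M)).ne'  -- positivity
  have hek : padicValNat 2 (classNumber M) = 2 ^ k - 1 := by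
    rw [← classNumberPExp_eq_padicValNat_classNumber κ k]; exact he
  -- valuations of both sides of `Fx * 2 * idx = h(M) * 2^t`
  have hv := congrArg (padicValNat 2) hchev
  rw [padicValNat.mul (mul_ne_zero hFx0 two_ne_zero) hidx0, padicValNat.mul hFx0 two_ne_zero,
    padicValNat.mul hhM (pow_ne_zero _ two_ne_zero), padicValNat.prime_pow, hek, padicValNat.self (by norm_num)] at hv
  -- `a ≤ v(Fx)` and `1 ≤ v(idx)`
  have hva : a ≤ padicValNat 2 Fx := (padicValNat_dvd_iff_le hFx0).mp hdvd
  have hvi : 1 ≤ padicValNat 2 idx := (padicValNat_dvd_iff_le hidx0).mp (by simpa using hidx)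
  -- `2^{k+1} - 1 ≤ 2a`, `t ≤ 2`
  have hpow : 2 ^ (k + 1) = 2 * 2 ^ k := by rw [pow_succ, mul_comm]
  have h1le : 1 ≤ 2 ^ k := Nat.one_le_two_pow
  omega

/-- ★★★ **THE QUADRATIC-STEP UNIT DOOR (displayed unit).**  As above, with the non-norm datum as ONE unit `u` of `K_{k+1}` coming from `K_k` that is not a
norm from `K_{k+1}`: `u ∈ E_{K_{k+1}} ∩ K_k`, `u ∉ N_{K_{k+1}/K_k} K_{k+1}ˣ` (tree `dvd_relIndex_unitsNorm_of_not_mem`: the index is then even).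
[cite: Lang1990, Ch. 13 §4, Lemma 4.1 (PDF p. 203)] [cite: Washington1997, §13.3 Prop. 13.22–13.23] -/
theorem classicalMuVanishes_two_of_unit_not_mem_norm_layer_succ (κ : ZpExtension K 2) (hκ : TotallyRamifiedFrom κ 0)
    (h0 : classNumberPExp κ 0 = 0) (h1 : classNumberPExp κ 1 ≤ 1) {k : ℕ}
    [NumberField (κ.layer k)] [NumberField (κ.layer (k + 1))]
    (ht : letI : Algebra (κ.layer k) (κ.layer (k + 1)) := (IntermediateField.inclusion (κ.layer_mono (Nat.le_succ k))).toRingHom.toAlgebra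
      {v : HeightOneSpectrum (𝓞 (κ.layer k)) | v.asIdeal.ramificationIdxIn (𝓞 (κ.layer (k + 1))) ≠ 1}.ncard ≤ 2)
    {u : (κ.layer (k + 1))ˣ}
    (hu : letI : Algebra (κ.layer k) (κ.layer (k + 1)) := (IntermediateField.inclusion (κ.layer_mono (Nat.le_succ k))).toRingHom.toAlgebra
      u ∈ unitsE (κ.layer (k + 1)) ⊓ (unitsIncl (κ.layer k) (κ.layer (k + 1))).range)
    (hnot : letI : Algebra (κ.layer k) (κ.layer (k + 1)) := (IntermediateField.inclusion (κ.layer_mono (Nat.le_succ k))).toRingHom.toAlgebra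
      u ∉ (⊤ : Subgroup (κ.layer (k + 1))ˣ).map (Herbrand.norm ((κ.layer (k + 1)) ≃ₐ[κ.layer k] (κ.layer (k + 1))))) :
    (∀ m, classGroupPRank κ m ≤ 2 ^ (k + 1) - 2) ∧ ClassicalMuVanishes κ ∧ classicalLambda κ ≤ 2 ^ (k + 1) - 2 := by
  have hML : κ.layer k ≤ κ.layer (k + 1) := κ.layer_mono (Nat.le_succ k)
  letI : Algebra (κ.layer k) (κ.layer (k + 1)) := (IntermediateField.inclusion hML).toRingHom.toAlgebra
  haveI : IsScalarTower K (κ.layer k) (κ.layer (k + 1)) :=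
    IsScalarTower.of_algebraMap_eq fun x => ((IntermediateField.inclusion hML).commutes x).symm
  haveI : FiniteDimensional K (κ.layer k) := κ.finiteDimensional_layer_holds _
  haveI : FiniteDimensional K (κ.layer (k + 1)) := κ.finiteDimensional_layer_holds _
  haveI : FiniteDimensional (κ.layer k) (κ.layer (k + 1)) := Module.Finite.of_restrictScalars_finite K (κ.layer k) (κ.layer (k + 1))
  haveI : IsGalois (κ.layer k) (κ.layer (k + 1)) := isGalois_layer_layer κ
  have hdeg : Module.finrank (κ.layer k) (κ.layer (k + 1)) = 2 ^ 1 := by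
    rw [finrank_layer_layer κ (show k ≤ k + 1 by omega), Nat.add_sub_cancel_left]
  have h2 := dvd_relIndex_unitsNorm_of_not_mem Nat.prime_two hdeg hu hnot
  exact classicalMuVanishes_two_of_two_dvd_unitsNormIndex_layer_succ κ hκ h0 h1 ht h2

end Literature.NumberTheory.IwasawaTheory

end
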